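import Mathlib.LinearAlgebra.BilinearForm.Orthogonal
import Mathlib.LinearAlgebra.QuadraticForm.Radical
import Literature.LinearAlgebra.QuadraticForm.WittGroup
import Literature.LinearAlgebra.QuadraticForm.KashiwaraIndexWittReduction
import HarnessLib

/-!
# Quadratic subquotients do not change the Witt class ([Thomas2006, Lemma 1])

Topic `LinearAlgebra/QuadraticForm`; namespace `Literature.LinearAlgebra.QuadraticForm`. KERNEL mathematics only
(theorems only; no definition, no named fact, no `axiom`, no `sorry`).

[Thomas2006, §1.3.2]: "we use the notion of quadratic subquotient: if `T` is a quadratic space and `I` an isotropic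
subspace, then `I^⊥/I` is again a quadratic space, called 'the quadratic subquotient of `T` by `I`.' … **Lemma 1.**
If `S` is a quadratic subquotient of `T` then `S` and `T` have the same class in `W(F)`. Proof. Suppose that
`S = I^⊥/I`. Choose a linear complement `M` to `I^⊥` in `T`. Then `M + I` (a direct sum) is a hyperbolic summand of
`S`, and `(M + I)^⊥ ⊂ I^⊥` maps isometrically onto `I^⊥/I`." This is the lemma behind the chain condition of the
Maslov index for non-transverse Lagrangians ([Thomas2006, Prop. 6]) and behind the comparison with Kashiwara's
index ([Thomas2006, Prop. 11]); [Rangarao1993, §2.4] uses the same passage to `M^⊥/M` for the Leray invariant.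

Rendering (Witt classes of ARBITRARY forms, `WittGroup.lean` / `WittEquivalence.lean`; `K` a field with `2 ≠ 0`,
`V` finite-dimensional, `Q` a quadratic form on `V` — degenerate forms allowed, their class being that of the
associated quadratic space — and `I ≤ V` totally isotropic, `Q(I) = 0`; `I^⊥` the orthogonal for the polar form):

* §1 (private plumbing) `(U^⊥)^⊥ = U + ker B` for a REFLEXIVE bilinear form on a finite-dimensional space (Mathlib
  has the nondegenerate case `LinearMap.BilinForm.orthogonal_orthogonal`; the general one follows from Mathlib's
  dimension formula `finrank_add_finrank_orthogonal`).
* §2 **`{Q|_{I^⊥}} = {Q}` in `W(K)`** (`wittClass_restrict_orthogonal`): the graph-like subspace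
  `L = {(y, y + j) : y ∈ I^⊥, j ∈ I + rad Q}` is a LAGRANGIAN of `Q|_{I^⊥} ⊕ (−Q)` (totally isotropic because
  `Q(j) = 0` and `j ⊥ I^⊥`; `L^⊥ ⊆ L` by §1), so `Q|_{I^⊥} ⊕ (−Q)` is split and `Q|_{I^⊥} ∼ Q`
  (`WittEquivalent.of_hasLagrangian_prod_neg`, [Knebusch2010, §1.2 Lemma 1.10]).
* §3 **Lemma 1 as printed, representation-free**: if `π : I^⊥ → S` is a linear surjection and `Q_S ∘ π = Q|_{I^⊥}`
  (so `(S, Q_S)` is a model of the subquotient `I^⊥/I`, or of `I^⊥/I'` for any `I ⊆ I' ⊆ I^⊥ ∩ (I^⊥)^⊥`), then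
  `{Q_S} = {Q}` (`wittClass_eq_of_subquotient`; the pull-back step is the tree's
  `WittEquivalent.comp_of_surjective`).

## References

* [Thomas2006] T. Thomas, *The Maslov index as a quadratic space*, Math. Res. Lett. 13 (2006) 985–999
  (arXiv:math/0505561), §1.3.2 Lemma 1.
* [Knebusch2010] M. Knebusch, *Specialization of Quadratic and Symmetric Bilinear Forms*, Springer (2010), Ch. 1
  §1.2 (Lemma 1.10, `W(K)`).
* [Rangarao1993] R. Ranga Rao, *On some explicit formulas in the theory of Weil representation*, Pacific J. Math.
  157 (1993) 335–371, §2.4 (pp. 343–344).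
-/

set_option autoImplicit false

noncomputable section

open QuadraticMap Module

namespace Literature.LinearAlgebra.QuadraticForm

universe u v w

variable {K : Type u} [Field K]
variable {V : Type v} [AddCommGroup V] [Module K V]
variable {W : Type w} [AddCommGroup W] [Module K W]

/-! ## §1 The double orthogonal of a subspace for a reflexive (possibly degenerate) form -/

/-- the kernel of a reflexive form is orthogonal to everything. [folklore] -/
private theorem ker_le_orthogonal {B : LinearMap.BilinForm K V} (hB : B.IsRefl) (U : Submodule K V) :
    LinearMap.ker B ≤ B.orthogonal U := fun x hx =>
  LinearMap.BilinForm.mem_orthogonal_iff.2 fun u _ => hB _ _ (by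
    rw [LinearMap.mem_ker] at hx
    exact LinearMap.congr_fun hx u)

/-- **`(U^⊥)^⊥ = U + ker B`** for a reflexive bilinear form on a finite-dimensional space (for non-degenerate `B`
this is Mathlib's `orthogonal_orthogonal`). [folklore] -/
private theorem orthogonal_orthogonal_eq_sup_ker [FiniteDimensional K V] {B : LinearMap.BilinForm K V} (hB : B.IsRefl)
    (U : Submodule K V) : B.orthogonal (B.orthogonal U) = U ⊔ LinearMap.ker B := by
  symm
  refine Submodule.eq_of_le_of_finrank_le (sup_le (LinearMap.BilinForm.le_orthogonal_orthogonal hB)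
    (ker_le_orthogonal hB _)) ?_
  have hker : B.orthogonal ⊤ = LinearMap.ker B := LinearMap.BilinForm.orthogonal_top_eq_ker hB
  have h₁ := LinearMap.BilinForm.finrank_add_finrank_orthogonal hB U
  have h₂ := LinearMap.BilinForm.finrank_add_finrank_orthogonal hB (B.orthogonal U)
  have h₃ := Submodule.finrank_sup_add_finrank_inf_eq U (LinearMap.ker B)
  have hinf : B.orthogonal U ⊓ B.orthogonal ⊤ = LinearMap.ker B := by
    rw [hker]
    exact inf_eq_right.2 (ker_le_orthogonal hB U)
  rw [hinf] at h₂
  rw [hker] at h₁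
  omega

/-! ## §2 Restriction to the orthogonal of an isotropic subspace -/

/-- **`Q₁ ⊕ (−Q₂)` split ⇒ `Q₁ ∼ Q₂`**: `Q₁ ∼ Q₁ ⊕ ((−Q₂) ⊕ Q₂) ∼ Q₂ ⊕ (Q₁ ⊕ (−Q₂)) ∼ Q₂`, both bracketed summands being split.
[cite: Knebusch2010, Ch. 1 §1.2 (Def. 1.8, Lemma 1.10)] -/
theorem WittEquivalent.of_hasLagrangian_prod_neg [NeZero (2 : K)] [FiniteDimensional K V] [FiniteDimensional K W]
    {Q₁ : QuadraticForm K V} {Q₂ : QuadraticForm K W} (h : HasLagrangian (Q₁.prod (-Q₂))) :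
    WittEquivalent Q₁ Q₂ := by
  have h₁ : HasLagrangian ((-Q₂).prod Q₂) := by
    have e := hasLagrangian_prod_neg (-Q₂)
    rwa [neg_neg] at e
  -- `Q₁ ∼ Q₁ ⊕ ((−Q₂) ⊕ Q₂) ∼ (Q₁ ⊕ −Q₂) ⊕ Q₂ ∼ Q₂ ⊕ (Q₁ ⊕ −Q₂) ∼ Q₂`
  exact ((((WittEquivalent.prod_of_hasLagrangian Q₁ h₁).symm.trans (wittEquivalent_prod_assoc Q₁ (-Q₂) Q₂).symm).trans
    (wittEquivalent_prod_comm _ _)).trans (WittEquivalent.prod_of_hasLagrangian Q₂ h))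

section Restrict

variable (Q : QuadraticForm K V) {I : Submodule K V}

/-- the polar form vanishes between `I^⊥` and `I` (orientation as needed below). [folklore] -/
private theorem polar_eq_zero_of_mem_orthogonal {y i : V} (hy : y ∈ (polarForm Q).orthogonal I) (hi : i ∈ I) :
    polar Q y i = 0 := by
  have h : polar Q i y = 0 := LinearMap.BilinForm.mem_orthogonal_iff.1 hy i hi
  rw [polar_comm]
  exact h

/-- `Q` vanishes on `I + rad Q` when it vanishes on `I`. [folklore] -/
private theorem map_eq_zero_of_mem_sup_radical (hI : IsTotallyIsotropic Q I) {j : V} (hj : j ∈ I ⊔ Q.radical) :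
    Q j = 0 := by
  obtain ⟨i, hi, r, hr, rfl⟩ := Submodule.mem_sup.1 hj
  rw [add_comm]
  exact ((QuadraticMap.mem_radical_iff'.1 hr).2 i).trans (hI i hi)

/-- the polar form vanishes between `I^⊥` and `I + rad Q`. [folklore] -/
private theorem polar_eq_zero_of_mem_orthogonal_of_mem_sup {y j : V} (hy : y ∈ (polarForm Q).orthogonal I)
    (hj : j ∈ I ⊔ Q.radical) : polar Q y j = 0 := by
  obtain ⟨i, hi, r, hr, rfl⟩ := Submodule.mem_sup.1 hj
  have hr' : polar Q y r = 0 := by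
    have e := QuadraticMap.mem_radical_iff'.1 hr
    rw [polar, add_comm, e.2 y, e.1]
    ring
  rw [polar_add_right, polar_eq_zero_of_mem_orthogonal Q hy hi, hr', add_zero]

/-- the kernel of the polar form lies in the radical (characteristic `≠ 2`). [folklore] -/
private theorem ker_polarForm_le_radical [NeZero (2 : K)] : LinearMap.ker (polarForm Q) ≤ Q.radical := by
  haveI : Invertible (2 : K) := invertibleOfNonzero (NeZero.ne 2)
  rw [QuadraticMap.radical_eq_ker_polarBilin]

variable [FiniteDimensional K V]

/-- **the Lagrangian `L = {(y, y + j) : y ∈ I^⊥, j ∈ I + rad Q}` of `Q|_{I^⊥} ⊕ (−Q)`** for `I` totally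
isotropic (characteristic `≠ 2`). [cite: Thomas2006, §1.3.2 Lemma 1 (proof: "`M + I` is a hyperbolic summand")] -/
theorem hasLagrangian_restrict_orthogonal_prod_neg [NeZero (2 : K)] (hI : IsTotallyIsotropic Q I) :
    HasLagrangian ((Q.restrict ((polarForm Q).orthogonal I)).prod (-Q)) := by
  set U : Submodule K V := (polarForm Q).orthogonal I with hU
  set P : QuadraticForm K U := Q.restrict U with hP
  -- the difference map `(y, z) ↦ z - y`
  set d : (U × V) →ₗ[K] V := LinearMap.snd K U V - U.subtype ∘ₗ LinearMap.fst K U V with hd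
  have hd_apply : ∀ p : U × V, d p = p.2 - (p.1 : V) := fun p => rfl
  set L : Submodule K (U × V) := (I ⊔ Q.radical).comap d with hL
  have hmemL : ∀ p : U × V, p ∈ L ↔ p.2 - (p.1 : V) ∈ I ⊔ Q.radical := fun p => by
    rw [hL, Submodule.mem_comap, hd_apply]
  -- values of the product form and of its polar form
  have hval : ∀ p : U × V, (P.prod (-Q)) p = Q (p.1 : V) - Q p.2 := fun p => by
    rw [QuadraticMap.prod_apply, QuadraticMap.neg_apply, hP, QuadraticMap.restrict_apply, sub_eq_add_neg]
  have hpol : ∀ p p' : U × V, polar (P.prod (-Q)) p p' = polar Q (p.1 : V) (p'.1 : V) - polar Q p.2 p'.2 := by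
    intro p p'
    simp only [polar, hval, Prod.fst_add, Prod.snd_add, Submodule.coe_add]
    ring
  -- totally isotropic
  have hiso : IsTotallyIsotropic (P.prod (-Q)) L := by
    intro p hp
    rw [hmemL] at hp
    have e : p.2 = (p.1 : V) + (p.2 - (p.1 : V)) := by abel
    rw [hval, e, map_add_eq_polar Q, map_eq_zero_of_mem_sup_radical Q hI hp,
      polar_eq_zero_of_mem_orthogonal_of_mem_sup Q p.1.2 hp]
    ring
  refine ⟨L, ?_, hiso⟩
  -- `L^⊥ = L`
  refine le_antisymm ?_ hiso.le_orthogonal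
  intro p hp
  rw [hmemL]
  -- test against `(y, y)` for `y ∈ I^⊥`: `polar Q y (p.1 - p.2) = 0`, so `p.1 - p.2 ∈ (I^⊥)^⊥ = I + ker`
  have htest : ∀ y : U, polar Q (y : V) ((p.1 : V) - p.2) = 0 := by
    intro y
    have hy : ((y, (y : V)) : U × V) ∈ L := by
      rw [hmemL]
      change (y : V) - (y : V) ∈ I ⊔ Q.radical
      rw [sub_self]
      exact Submodule.zero_mem _
    have e : polar (P.prod (-Q)) ((y, (y : V)) : U × V) p = 0 :=
      LinearMap.BilinForm.mem_orthogonal_iff.1 hp _ hy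
    rw [hpol] at e
    change polar Q (y : V) (p.1 : V) - polar Q (y : V) p.2 = 0 at e
    rwa [← polar_sub_right] at e
  have hmem : (p.1 : V) - p.2 ∈ (polarForm Q).orthogonal ((polarForm Q).orthogonal I) :=
    LinearMap.BilinForm.mem_orthogonal_iff.2 fun y hy => by
      change polar Q y ((p.1 : V) - p.2) = 0
      exact htest ⟨y, hy⟩
  rw [orthogonal_orthogonal_eq_sup_ker (polarForm_isRefl Q)] at hmem
  have hmem' : (p.1 : V) - p.2 ∈ I ⊔ Q.radical :=
    (sup_le_sup_left (ker_polarForm_le_radical Q) I) hmem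
  have e : p.2 - (p.1 : V) = -((p.1 : V) - p.2) := by abel
  rw [e]
  exact Submodule.neg_mem _ hmem'

/-- **restricting to the orthogonal of a totally isotropic subspace does not change the Witt class**:
`Q|_{I^⊥} ∼ Q` (`Q(I) = 0`; degenerate `Q` allowed; characteristic `≠ 2`). [cite: Thomas2006, §1.3.2 Lemma 1] -/
theorem wittEquivalent_restrict_orthogonal [NeZero (2 : K)] (hI : IsTotallyIsotropic Q I) :
    WittEquivalent (Q.restrict ((polarForm Q).orthogonal I)) Q :=
  WittEquivalent.of_hasLagrangian_prod_neg (hasLagrangian_restrict_orthogonal_prod_neg Q hI)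

/-- **`{Q|_{I^⊥}} = {Q}` in `W(K)`.** [cite: Thomas2006, §1.3.2 Lemma 1] -/
theorem wittClass_restrict_orthogonal [NeZero (2 : K)] (hI : IsTotallyIsotropic Q I) :
    wittClass (Q.restrict ((polarForm Q).orthogonal I)) = wittClass Q :=
  wittClass_eq_iff.2 (wittEquivalent_restrict_orthogonal Q hI)

/-! ## §3 Lemma 1 as printed: a quadratic subquotient has the Witt class of the space -/

/-- **pull-back along a linear surjection does not change the Witt class** (`P ∘ π ≅ P ⊥ 0_{ker π}`; re-stated from
`KashiwaraIndexWittReduction.lean` for forms on arbitrary carriers). [cite: Knebusch2010, §1.6 Def. 1.74] -/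
theorem wittClass_comp_of_surjective [FiniteDimensional K W] (P : QuadraticForm K V) (π : W →ₗ[K] V)
    (hπ : Function.Surjective π) : wittClass (P.comp π) = wittClass P :=
  wittClass_eq_iff.2 (WittEquivalent.comp_of_surjective P π hπ)

/-- **[Thomas2006, Lemma 1]: "If `S` is a quadratic subquotient of `T` then `S` and `T` have the same class in
`W(F)`"** — representation-free: whenever `Q|_{I^⊥} = Q_S ∘ π` for a linear surjection `π : I^⊥ → S` (`I` totally
isotropic; e.g. `S = I^⊥/I` with its induced form), `{Q_S} = {Q}` (degenerate `Q` allowed; characteristic `≠ 2`).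
[cite: Thomas2006, §1.3.2 Lemma 1] -/
theorem wittClass_eq_of_subquotient [NeZero (2 : K)] {S : Type w} [AddCommGroup S] [Module K S]
    [FiniteDimensional K S] (hI : IsTotallyIsotropic Q I) (QS : QuadraticForm K S)
    (π : (polarForm Q).orthogonal I →ₗ[K] S) (hπ : Function.Surjective π)
    (h : Q.restrict ((polarForm Q).orthogonal I) = QS.comp π) : wittClass QS = wittClass Q := by
  rw [← wittClass_restrict_orthogonal Q hI, h, wittClass_comp_of_surjective QS π hπ]

/-- the same as a `WittEquivalent` statement. [cite: Thomas2006, §1.3.2 Lemma 1] -/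
theorem wittEquivalent_of_subquotient [NeZero (2 : K)] {S : Type w} [AddCommGroup S] [Module K S]
    [FiniteDimensional K S] (hI : IsTotallyIsotropic Q I) (QS : QuadraticForm K S)
    (π : (polarForm Q).orthogonal I →ₗ[K] S) (hπ : Function.Surjective π)
    (h : Q.restrict ((polarForm Q).orthogonal I) = QS.comp π) : WittEquivalent QS Q :=
  wittClass_eq_iff.1 (wittClass_eq_of_subquotient Q hI QS π hπ h)

end Restrict

end Literature.LinearAlgebra.QuadraticForm
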